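import Summits.HodgeConjecture.HodgeConjecture.Theorems.F0P3cStCharTSCharacterEllipticUniform   -- ★ 41g-H p853315 (this seat): §1 transport, the place-free §2 letters, the UNR heads (twinned here)
import Literature.NumberTheory.Automorphic.UnitaryLatticeTreeLevelGroupsPackage               -- ★ 41g FILE P + §6 `_of_v` place-free twins (this seat)
import Literature.NumberTheory.Automorphic.UnitaryLatticeTreeGeodesicInclusionOfInvolution     -- ★ B1 FILE 2 p853468 (LH5-p04): (U7) `_of_involution` ∕ `_of_neg`
import Literature.NumberTheory.Automorphic.UnitaryLatticeTreeFramesOfInvolution               -- ★ `isTree_latticeGraph_three_of_neg`, `ncard_sphere_of_neg`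
import HarnessLib

/-!
# F0 · P3c · «StCharTS» — E1 B2 «41g-RAM»: (SS-K) UNIFORM AT THE DATUM, PLACE-FREE AND AT A TAME RAMIFIED PLACE
# `𝔇.char π γ = Σ_{x ∈ X^γ} tr(γ | π^{U_x}) − Σ_{d ∈ X₁^γ} tr(γ | π^{U_d})` on the `U(Φ₃)(L⁺_v)` tree when `σ_w ϖ = −ϖ`  [SS97 III.4.16; Korman2004 Thm. 40; Rogawski1990 §12.5]

Cell `pub/hodgecm-mathlib`, crux H413 = `stmt-HodgeConjecture-24833` (`--supports … --as helper`), route HCCMUnconditional; E1 BRICK LEDGER B2 «41g-RAM» (keeper F0P3a-p03 (g30)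
03:56:55Z; LEAD T15-42 (iii): tame twins by the file's own pen); seat LH6-p04 (g11).  THEOREMS ONLY (no definition, no instance, no notation, no named fact, no `sorry`).
Sibling of ★ `…F0P3cStCharTSCharacterEllipticUniform` (41g-H): the SEVEN datum lemmas and the HEAD that read `hd : UnramifiedLocalConjDatum σ_w ϖ` are re-issued with the
suffix `_of_involution` (place letters hypothesis-style: `hvσ hϖ`; for (U7) and the head also `hσ`, the tree `hT`, the self-dual frames `hfr`, type-two transitivity `htr₂`,
and for the head local finiteness `hloc`) and `_of_neg` (TAME dischargers `hσ hvσ hϖ hσϖ hres h2 hnorm`); conclusions VERBATIM.  The place-free letters of 41g-H (§1 transport,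
`exists_actionHom_unitaryLevelFamily`, `map_unitaryLevel_mem_iff`, `unitaryLevel_eq_comap_map`, `isOpen_setOf_actionHom_apply_eq`, `unitaryLevel_gqs_actionHom_eq_map_conj`,
`actionHom_apply_eq_of_mem`, `mem_normalizer_unitaryLevel_gqs_of_apply_eq`) are used BY NAME.  INPUTS: ★ FILE P §6 (`coe_sup_unitaryLevel_eq_mul_of_adj_of_v`,
`isCompact_coe_sup_unitaryLevel_of_adj_of_v`, `latticeGraphIso_apply_eq_of_mem_unitaryLevel_of_adj_of_v`), ★ B1 FILE 2 (`unitaryLevel_subset_mul_of_adj_of_dist_subtype_of_involution`),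
★ `isTree_latticeGraph_three_of_neg`, ★ `ncard_sphere_of_neg`, ★ 41f B2, ★ row 25 §1, ★ 41c, ★ row 23.
HONEST LABEL: count-neutral datum helper; TAME road GO-LOW (LEAD T15-42); WILD (dyadic) places stay PRINT (`h2 : |2| = 1` is a binder); HC_CM is proved only modulo the 7 printed
citations (2 remaining: hLiu418 = stmt-HodgeConjecture-24832, h413 = stmt-HodgeConjecture-24833) until rung 0 closes.

## References
* [SchneiderStuhler1997] P. Schneider, U. Stuhler, *Representation theory and sheaves on the Bruhat–Tits building*, Publ. IHÉS 85 (1997): Ch. I §2–§3, Thm. III.4.16.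
* [Korman2004] J. Korman, *On the local constancy of characters*, arXiv:math/0409292: §3.6, §9 Claim 39, Thm. 40.
* [MeyerSolleveld2010] R. Meyer, M. Solleveld, *Resolutions for representations of reductive p-adic groups via their buildings*, Crelle 647 (2010): Prop. 4.1.
* [BruhatTits1972] F. Bruhat, J. Tits, *Groupes réductifs sur un corps local I*, Publ. Math. IHÉS 41 (1972), (7.4.18), §10.
* [Rogawski1990] J. D. Rogawski, *Automorphic Representations of Unitary Groups in Three Variables* (1990): §12.5 pp. 182–187.
-/

set_option autoImplicit false
-- the mandated namespace has the single-problem summit's repeated segment (`HodgeConjecture.HodgeConjecture`)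
set_option linter.dupNamespace false

noncomputable section

open NumberField IsDedekindDomain MeasureTheory
open scoped Pointwise Valued WithZero
open Literature.NumberTheory.Rogawski1990 Literature.NumberTheory.Rogawski1990.Ch12Sec5
open Literature.NumberTheory.Automorphic Literature.NumberTheory.Automorphic.UnitaryGroup Literature.NumberTheory.Automorphic.UnitaryLatticeTree
open Literature.NumberTheory.Automorphic.HermitianLattice
open Literature.Combinatorics.SimpleGraph Literature.Combinatorics.SimpleGraph.OrientedIncidence

namespace Summit.HodgeConjecture.HodgeConjecture.Cruxes.H413.F0P3cStCharTSCharacterEllipticUniformRamified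

open Summit.HodgeConjecture.HodgeConjecture.Cruxes.H413
open Summit.HodgeConjecture.HodgeConjecture.Cruxes.H413.F0P3cStCharTSCharacterEllipticUniform

/-! ## §2 The seven datum letters that read `hd`, place-free (`_of_involution`) -/

section Datum

variable (L : Type) [Field L] [NumberField L] [IsCMField L] (v : HeightOneSpectrum (𝓞 ↥(maximalRealSubfield L)))
  (w : PlacesOver L v) (hw : IsCMField.complexConj L • w.1 = w.1) {ϖ : w.1.adicCompletion L}
  (eA : Gqs L v ≃ₜ* ↥(unitaryGroupOfForm (galAdicCompletionMap (L := L) (IsCMField.complexConj L) hw) ((StdForm.antidiagonal 3).over (w.1.adicCompletion L))))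

variable {L v w hw eA}
variable {a : Gqs L v →* ((latticeGraph (galAdicCompletionMap (L := L) (IsCMField.complexConj L) hw) ϖ ((StdForm.antidiagonal 3).over (w.1.adicCompletion L))) ≃g (latticeGraph (galAdicCompletionMap (L := L) (IsCMField.complexConj L) hw) ϖ ((StdForm.antidiagonal 3).over (w.1.adicCompletion L))))} (ha : ∀ g, a g = latticeGraphIso (galAdicCompletionMap (L := L) (IsCMField.complexConj L) hw) ϖ ((StdForm.antidiagonal 3).over (w.1.adicCompletion L)) (eA g))
  {e : ℕ} {U : {M : Submodule 𝒪[(w.1.adicCompletion L)] (Fin 3 → (w.1.adicCompletion L)) // IsVertex (galAdicCompletionMap (L := L) (IsCMField.complexConj L) hw) ϖ ((StdForm.antidiagonal 3).over (w.1.adicCompletion L)) M} → Subgroup (Gqs L v)}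
  (hU : ∀ x g, g ∈ U x ↔ mapGL ((eA g : ↥(unitaryGroupOfForm (galAdicCompletionMap (L := L) (IsCMField.complexConj L) hw) ((StdForm.antidiagonal 3).over (w.1.adicCompletion L)))) : GL (Fin 3) (w.1.adicCompletion L)) x.1 = x.1 ∧
    x.1.map ((Matrix.toLin' ((((eA g : ↥(unitaryGroupOfForm (galAdicCompletionMap (L := L) (IsCMField.complexConj L) hw) ((StdForm.antidiagonal 3).over (w.1.adicCompletion L)))) : GL (Fin 3) (w.1.adicCompletion L)) : Matrix (Fin 3) (Fin 3) (w.1.adicCompletion L)) - 1)).restrictScalars 𝒪[(w.1.adicCompletion L)]) ≤ scaleLattice (ϖ ^ (e + 1)) x.1)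

include hU in
/-- **`hUo`**: `U x` is open. [cite: SchneiderStuhler1997, Ch. I §2 (U1)] — PLACE-FREE twin (`hd ↦ hvσ hϖ`, resp. `hσ hvσ hϖ hT hfr htr₂` for (U7)). -/
theorem isOpen_coe_unitaryLevel_gqs_of_involution (hϖ : Valued.v ϖ = WithZero.exp (-1 : ℤ)) (x : {M : Submodule 𝒪[(w.1.adicCompletion L)] (Fin 3 → (w.1.adicCompletion L)) // IsVertex (galAdicCompletionMap (L := L) (IsCMField.complexConj L) hw) ϖ ((StdForm.antidiagonal 3).over (w.1.adicCompletion L)) M}) : IsOpen (U x : Set (Gqs L v)) := by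
  have hc0 : ϖ ^ (e + 1) ≠ 0 := pow_ne_zero _ (CartanUnique.uniformizer_ne_zero hϖ)
  have hc1 : Valued.v (ϖ ^ (e + 1)) < 1 := by
    rw [CartanUnique.v_uniformizer_pow hϖ, ← WithZero.exp_zero, WithZero.exp_lt_exp]; omega
  rw [unitaryLevel_eq_comap_map (eA := eA) (U := U) x]
  exact isOpen_coe_comap eA _ (isOpen_coe_unitaryLevel (map_unitaryLevel_mem_iff hU) hc0 hc1 x)

include hU in
/-- **`hUc`**: `U x` is compact (`𝒪_w` compact, `σ_w` continuous). [cite: SchneiderStuhler1997, Ch. I §2 (U1)] [cite: BruhatTits1972, §10] — PLACE-FREE twin (`hd ↦ hvσ hϖ`, resp. `hσ hvσ hϖ hT hfr htr₂` for (U7)). -/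
theorem isCompact_coe_unitaryLevel_gqs_of_involution (hϖ : Valued.v ϖ = WithZero.exp (-1 : ℤ)) (x : {M : Submodule 𝒪[(w.1.adicCompletion L)] (Fin 3 → (w.1.adicCompletion L)) // IsVertex (galAdicCompletionMap (L := L) (IsCMField.complexConj L) hw) ϖ ((StdForm.antidiagonal 3).over (w.1.adicCompletion L)) M}) : IsCompact (U x : Set (Gqs L v)) := by
  haveI := compactSpace_integer_adicCompletion L w.1
  have hσc : Continuous (galAdicCompletionMap (L := L) (IsCMField.complexConj L) hw) := continuous_galAdicCompletionMap L (IsCMField.complexConj L) hw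
  have hc0 : ϖ ^ (e + 1) ≠ 0 := pow_ne_zero _ (CartanUnique.uniformizer_ne_zero hϖ)
  have hc1 : Valued.v (ϖ ^ (e + 1)) < 1 := by
    rw [CartanUnique.v_uniformizer_pow hϖ, ← WithZero.exp_zero, WithZero.exp_lt_exp]; omega
  rw [unitaryLevel_eq_comap_map (eA := eA) (U := U) x]
  exact isCompact_coe_comap eA _ (isCompact_coe_unitaryLevel (map_unitaryLevel_mem_iff hU) hσc hc0 hc1 x)

include hU in
/-- **`hU6`** AT THE DATUM: `↑(U x ⊔ U y) = ↑(U x) * ↑(U y)` for adjacent vertices (★ FILE P `coe_sup_unitaryLevel_eq_mul_of_adj` through `eA`). [cite: SchneiderStuhler1997, Ch. I §2 (U6)] — PLACE-FREE twin (`hd ↦ hvσ hϖ`, resp. `hσ hvσ hϖ hT hfr htr₂` for (U7)). -/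
theorem coe_sup_unitaryLevel_gqs_eq_mul_of_adj_of_involution (hvσ : ∀ a, Valued.v ((galAdicCompletionMap (L := L) (IsCMField.complexConj L) hw) a) = Valued.v a) (hϖ : Valued.v ϖ = WithZero.exp (-1 : ℤ)) {x y : {M : Submodule 𝒪[(w.1.adicCompletion L)] (Fin 3 → (w.1.adicCompletion L)) // IsVertex (galAdicCompletionMap (L := L) (IsCMField.complexConj L) hw) ϖ ((StdForm.antidiagonal 3).over (w.1.adicCompletion L)) M}} (hxy : (latticeGraph (galAdicCompletionMap (L := L) (IsCMField.complexConj L) hw) ϖ ((StdForm.antidiagonal 3).over (w.1.adicCompletion L))).Adj x y) :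
    ((U x ⊔ U y : Subgroup (Gqs L v)) : Set (Gqs L v)) = (U x : Set (Gqs L v)) * (U y : Set (Gqs L v)) := by
  rw [unitaryLevel_eq_comap_map (eA := eA) (U := U) x, unitaryLevel_eq_comap_map (eA := eA) (U := U) y]
  exact coe_sup_comap_eq_mul eA (coe_sup_unitaryLevel_eq_mul_of_adj_of_v (map_unitaryLevel_mem_iff hU) hvσ hϖ hxy)

include hU in
/-- **`hU7`** AT THE DATUM (★ δ through `eA`): `G.Adj x y → dist y z + 1 = dist x z → ↑(U y) ⊆ ↑(U x) * ↑(U z)`. [cite: SchneiderStuhler1997, Prop. I.3.1] [cite: Korman2004, §3.6 (U7)] — PLACE-FREE twin (`hd ↦ hvσ hϖ`, resp. `hσ hvσ hϖ hT hfr htr₂` for (U7)). -/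
theorem coe_unitaryLevel_gqs_subset_mul_of_adj_of_dist_of_involution (hσ : ∀ a, (galAdicCompletionMap (L := L) (IsCMField.complexConj L) hw) ((galAdicCompletionMap (L := L) (IsCMField.complexConj L) hw) a) = a) (hvσ : ∀ a, Valued.v ((galAdicCompletionMap (L := L) (IsCMField.complexConj L) hw) a) = Valued.v a) (hϖ : Valued.v ϖ = WithZero.exp (-1 : ℤ))
    (hT : (latticeGraph (galAdicCompletionMap (L := L) (IsCMField.complexConj L) hw) ϖ ((StdForm.antidiagonal 3).over (w.1.adicCompletion L))).IsTree)
    (hfr : ∀ M : Submodule 𝒪[(w.1.adicCompletion L)] (Fin 3 → (w.1.adicCompletion L)), IsSelfDualLattice (galAdicCompletionMap (L := L) (IsCMField.complexConj L) hw) ϖ ((StdForm.antidiagonal 3).over (w.1.adicCompletion L)) M →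
      ∃ k : unitaryGroupOfForm (galAdicCompletionMap (L := L) (IsCMField.complexConj L) hw) ((StdForm.antidiagonal 3).over (w.1.adicCompletion L)), k ∈ unitaryInt (galAdicCompletionMap (L := L) (IsCMField.complexConj L) hw) ((StdForm.antidiagonal 3).over (w.1.adicCompletion L)) ∧
        ∃ n : ℤ, M = mapGL (k : GL (Fin 3) (w.1.adicCompletion L)) (latt (Matrix.diagonal ![ϖ ^ n, 1, ϖ ^ (-n)])))
    (htr₂ : ∀ M : Submodule 𝒪[(w.1.adicCompletion L)] (Fin 3 → (w.1.adicCompletion L)), IsVertexLattice (galAdicCompletionMap (L := L) (IsCMField.complexConj L) hw) ϖ ((StdForm.antidiagonal 3).over (w.1.adicCompletion L)) 2 M →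
      ∃ u : unitaryGroupOfForm (galAdicCompletionMap (L := L) (IsCMField.complexConj L) hw) ((StdForm.antidiagonal 3).over (w.1.adicCompletion L)), M = mapGL (u : GL (Fin 3) (w.1.adicCompletion L)) (latt (Matrix.diagonal ![(1 : (w.1.adicCompletion L)), 1, ϖ]))) {x y z : {M : Submodule 𝒪[(w.1.adicCompletion L)] (Fin 3 → (w.1.adicCompletion L)) // IsVertex (galAdicCompletionMap (L := L) (IsCMField.complexConj L) hw) ϖ ((StdForm.antidiagonal 3).over (w.1.adicCompletion L)) M}} (hxy : (latticeGraph (galAdicCompletionMap (L := L) (IsCMField.complexConj L) hw) ϖ ((StdForm.antidiagonal 3).over (w.1.adicCompletion L))).Adj x y)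
    (hyz : (latticeGraph (galAdicCompletionMap (L := L) (IsCMField.complexConj L) hw) ϖ ((StdForm.antidiagonal 3).over (w.1.adicCompletion L))).dist y z + 1 = (latticeGraph (galAdicCompletionMap (L := L) (IsCMField.complexConj L) hw) ϖ ((StdForm.antidiagonal 3).over (w.1.adicCompletion L))).dist x z) :
    ((U y : Subgroup (Gqs L v)) : Set (Gqs L v)) ⊆ (U x : Set (Gqs L v)) * (U z : Set (Gqs L v)) := by
  have hc0 : ϖ ^ (e + 1) ≠ 0 := pow_ne_zero _ (CartanUnique.uniformizer_ne_zero hϖ)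
  have hc1 : Valued.v (ϖ ^ (e + 1)) < 1 := by
    rw [CartanUnique.v_uniformizer_pow hϖ, ← WithZero.exp_zero, WithZero.exp_lt_exp]; omega
  rw [unitaryLevel_eq_comap_map (eA := eA) (U := U) x, unitaryLevel_eq_comap_map (eA := eA) (U := U) y, unitaryLevel_eq_comap_map (eA := eA) (U := U) z]
  exact coe_comap_subset_mul eA (unitaryLevel_subset_mul_of_adj_of_dist_subtype_of_involution hσ hvσ hϖ hT hfr htr₂ hc0 hc1 rfl (fun x => (U x).map eA.toMonoidHom)
    (map_unitaryLevel_mem_iff hU) hxy hyz)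

include hU in
/-- **`hEo`**: the edge group `U x ⊔ U y` is open. [cite: SchneiderStuhler1997, Ch. I §2 (U1)] — PLACE-FREE twin (`hd ↦ hvσ hϖ`, resp. `hσ hvσ hϖ hT hfr htr₂` for (U7)). -/
theorem isOpen_coe_sup_unitaryLevel_gqs_of_involution (hϖ : Valued.v ϖ = WithZero.exp (-1 : ℤ)) (x y : {M : Submodule 𝒪[(w.1.adicCompletion L)] (Fin 3 → (w.1.adicCompletion L)) // IsVertex (galAdicCompletionMap (L := L) (IsCMField.complexConj L) hw) ϖ ((StdForm.antidiagonal 3).over (w.1.adicCompletion L)) M}) : IsOpen ((U x ⊔ U y : Subgroup (Gqs L v)) : Set (Gqs L v)) :=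
  Subgroup.isOpen_mono le_sup_left (isOpen_coe_unitaryLevel_gqs_of_involution hU hϖ x)

include hU in
/-- **`hEc`**: the edge group of an edge is compact. [cite: SchneiderStuhler1997, Ch. I §2 (U1)(U6)] — PLACE-FREE twin (`hd ↦ hvσ hϖ`, resp. `hσ hvσ hϖ hT hfr htr₂` for (U7)). -/
theorem isCompact_coe_sup_unitaryLevel_gqs_of_adj_of_involution (hvσ : ∀ a, Valued.v ((galAdicCompletionMap (L := L) (IsCMField.complexConj L) hw) a) = Valued.v a) (hϖ : Valued.v ϖ = WithZero.exp (-1 : ℤ)) {x y : {M : Submodule 𝒪[(w.1.adicCompletion L)] (Fin 3 → (w.1.adicCompletion L)) // IsVertex (galAdicCompletionMap (L := L) (IsCMField.complexConj L) hw) ϖ ((StdForm.antidiagonal 3).over (w.1.adicCompletion L)) M}} (hxy : (latticeGraph (galAdicCompletionMap (L := L) (IsCMField.complexConj L) hw) ϖ ((StdForm.antidiagonal 3).over (w.1.adicCompletion L))).Adj x y) :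
    IsCompact ((U x ⊔ U y : Subgroup (Gqs L v)) : Set (Gqs L v)) := by
  rw [coe_sup_unitaryLevel_gqs_eq_mul_of_adj_of_involution hU hvσ hϖ hxy]
  exact (isCompact_coe_unitaryLevel_gqs_of_involution hU hϖ x).mul (isCompact_coe_unitaryLevel_gqs_of_involution hU hϖ y)

include ha hU in
/-- **Level ≥ 1 fixes the closed star** at the datum (41f's `hKF`∕`hKN` once `K ≤ U x`): a member of `U x` fixes every neighbour of `x`. [cite: SchneiderStuhler1997, Ch. I §2 (U4)]
[cite: Korman2004, §9 Claim 39] — PLACE-FREE twin (`hd ↦ hvσ hϖ`, resp. `hσ hvσ hϖ hT hfr htr₂` for (U7)). -/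
theorem actionHom_apply_eq_of_mem_of_adj_of_involution (hvσ : ∀ a, Valued.v ((galAdicCompletionMap (L := L) (IsCMField.complexConj L) hw) a) = Valued.v a) (hϖ : Valued.v ϖ = WithZero.exp (-1 : ℤ)) {g : Gqs L v} {x y : {M : Submodule 𝒪[(w.1.adicCompletion L)] (Fin 3 → (w.1.adicCompletion L)) // IsVertex (galAdicCompletionMap (L := L) (IsCMField.complexConj L) hw) ϖ ((StdForm.antidiagonal 3).over (w.1.adicCompletion L)) M}} (hg : g ∈ U x) (hxy : (latticeGraph (galAdicCompletionMap (L := L) (IsCMField.complexConj L) hw) ϖ ((StdForm.antidiagonal 3).over (w.1.adicCompletion L))).Adj x y) : a g y = y := by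
  rw [ha]
  exact latticeGraphIso_apply_eq_of_mem_unitaryLevel_of_adj_of_v (map_unitaryLevel_mem_iff hU) hvσ hϖ (Subgroup.mem_map_of_mem eA.toMonoidHom hg) hxy

include hU in
/-- **`hU7` AT A TAME RAMIFIED PLACE** (`σϖ = −ϖ`, `hres`, `|2| = 1`, `hnorm`): the three involution-form hypotheses of `coe_unitaryLevel_gqs_subset_mul_of_adj_of_dist_of_involution`
discharged by ★ `isTree_latticeGraph_three_of_neg`, ★ `exists_frame_three_of_isSelfDualLattice_of_neg`, ★ `forall_isVertexLattice_two_exists_mapGL_N₁_eq_of_neg` (★ B1 FILE 2's `_of_neg` pattern).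
[cite: SchneiderStuhler1997, Prop. I.3.1] [cite: Korman2004, §3.6 (U7)] [cite: BruhatTits1972, (7.4.18)] -/
theorem coe_unitaryLevel_gqs_subset_mul_of_adj_of_dist_of_neg
    (hσ : ∀ a, (galAdicCompletionMap (L := L) (IsCMField.complexConj L) hw) ((galAdicCompletionMap (L := L) (IsCMField.complexConj L) hw) a) = a) (hvσ : ∀ a, Valued.v ((galAdicCompletionMap (L := L) (IsCMField.complexConj L) hw) a) = Valued.v a)
    (hϖ : Valued.v ϖ = WithZero.exp (-1 : ℤ)) (hσϖ : (galAdicCompletionMap (L := L) (IsCMField.complexConj L) hw) ϖ = -ϖ)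
    (hres : ∀ x : (w.1.adicCompletion L), Valued.v x ≤ 1 → Valued.v ((galAdicCompletionMap (L := L) (IsCMField.complexConj L) hw) x - x) < 1) (h2 : Valued.v (2 : (w.1.adicCompletion L)) = 1)
    (hnorm : ∀ u : (w.1.adicCompletion L), (galAdicCompletionMap (L := L) (IsCMField.complexConj L) hw) u = u → Valued.v (u - 1) < 1 → ∃ z : (w.1.adicCompletion L), z * (galAdicCompletionMap (L := L) (IsCMField.complexConj L) hw) z = u ∧ Valued.v (z - 1) ≤ Valued.v (u - 1))
    {x y z : {M : Submodule 𝒪[(w.1.adicCompletion L)] (Fin 3 → (w.1.adicCompletion L)) // IsVertex (galAdicCompletionMap (L := L) (IsCMField.complexConj L) hw) ϖ ((StdForm.antidiagonal 3).over (w.1.adicCompletion L)) M}} (hxy : (latticeGraph (galAdicCompletionMap (L := L) (IsCMField.complexConj L) hw) ϖ ((StdForm.antidiagonal 3).over (w.1.adicCompletion L))).Adj x y)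
    (hyz : (latticeGraph (galAdicCompletionMap (L := L) (IsCMField.complexConj L) hw) ϖ ((StdForm.antidiagonal 3).over (w.1.adicCompletion L))).dist y z + 1 = (latticeGraph (galAdicCompletionMap (L := L) (IsCMField.complexConj L) hw) ϖ ((StdForm.antidiagonal 3).over (w.1.adicCompletion L))).dist x z) :
    ((U y : Subgroup (Gqs L v)) : Set (Gqs L v)) ⊆ (U x : Set (Gqs L v)) * (U z : Set (Gqs L v)) :=
  coe_unitaryLevel_gqs_subset_mul_of_adj_of_dist_of_involution hU hσ hvσ hϖ (isTree_latticeGraph_three_of_neg hσ hvσ hϖ hσϖ hres h2 hnorm)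
    (exists_frame_three_of_isSelfDualLattice_of_neg hσ hvσ hϖ h2) (forall_isVertexLattice_two_exists_mapGL_N₁_eq_of_neg hσ hvσ hϖ hσϖ hres h2 hnorm) hxy hyz

end Datum

/-! ## §3 THE HEAD, PLACE-FREE (`_of_involution`) and AT A TAME RAMIFIED PLACE (`_of_neg`) -/

section Head

variable (L : Type) [Field L] [NumberField L] [IsCMField L] (v : HeightOneSpectrum (𝓞 ↥(maximalRealSubfield L)))

set_option maxHeartbeats 1600000 in
/-- **(SS-K) UNIFORM AT THE DATUM** — the Schneider–Stuhler ∕ Korman character formula on the `U(Φ₃)(L⁺_v)` tree, density-free and truncation-free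
([SchneiderStuhler1997 Thm. III.4.16–17], [Korman2004 Thm. 40], [MeyerSolleveld2010 Prop. 4.1], census 38 (A13) @ datum; ★ 41f `levelTrace_eq_fixedVertexSum_sub_fixedEdgeSum` over
★ row 25 §1).  At a non-split place `v`, PLACE-FREE in the tree letters ((G3) letters `(w hw ϖ eA)` with `hd` replaced by `hσ hvσ hϖ`, the tree `hT`, local finiteness `hloc`, the self-dual frames `hfr` and type-two transitivity `htr₂`), for the action hom `a` and the unitary level family `U` at level `ϖ^(e+1)` (§2, hypothesis-style
`ha hU`, binders `hUo hUc hEo hEc`), a §12.5 datum `𝔇` with `𝔇.μG = νQv` Haar and `𝔇.char (IrrClass.mk r)` representing the character (`hrep`), a level with a non-zero fixed vector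
(`he`), and `γ` with non-empty finite fixed tree (`hne`, `hfin`, `hfinE`) at which the character is locally constant (`hHC`):
`𝔇.char (IrrClass.mk r) γ = Σ_{x ∈ X^γ⁰} tr(γ | π^{U_x}) − Σ_{d ∈ X^γ¹} tr(γ | π^{U_d})`.
[cite: SchneiderStuhler1997, Thm. III.4.16] [cite: Korman2004, Theorem 40] [cite: MeyerSolleveld2010, Prop. 4.1] [cite: Rogawski1990, §12.5 pp. 182–187] -/
theorem char_eq_fixedVertexSum_sub_fixedEdgeSum_of_involution
    (hns : ∀ w : PlacesOver L v, IsCMField.complexConj L • w.1 = w.1)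
    (w : PlacesOver L v) (hw : IsCMField.complexConj L • w.1 = w.1) {ϖ : w.1.adicCompletion L} (hσ : ∀ a, (galAdicCompletionMap (L := L) (IsCMField.complexConj L) hw) ((galAdicCompletionMap (L := L) (IsCMField.complexConj L) hw) a) = a) (hvσ : ∀ a, Valued.v ((galAdicCompletionMap (L := L) (IsCMField.complexConj L) hw) a) = Valued.v a) (hϖ : Valued.v ϖ = WithZero.exp (-1 : ℤ))
    (hT : (latticeGraph (galAdicCompletionMap (L := L) (IsCMField.complexConj L) hw) ϖ ((StdForm.antidiagonal 3).over (w.1.adicCompletion L))).IsTree)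
    (hloc : ∀ x : {M : Submodule 𝒪[(w.1.adicCompletion L)] (Fin 3 → (w.1.adicCompletion L)) // IsVertex (galAdicCompletionMap (L := L) (IsCMField.complexConj L) hw) ϖ ((StdForm.antidiagonal 3).over (w.1.adicCompletion L)) M}, ((latticeGraph (galAdicCompletionMap (L := L) (IsCMField.complexConj L) hw) ϖ ((StdForm.antidiagonal 3).over (w.1.adicCompletion L))).neighborSet x).Finite)
    (hfr : ∀ M : Submodule 𝒪[(w.1.adicCompletion L)] (Fin 3 → (w.1.adicCompletion L)), IsSelfDualLattice (galAdicCompletionMap (L := L) (IsCMField.complexConj L) hw) ϖ ((StdForm.antidiagonal 3).over (w.1.adicCompletion L)) M →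
      ∃ k : unitaryGroupOfForm (galAdicCompletionMap (L := L) (IsCMField.complexConj L) hw) ((StdForm.antidiagonal 3).over (w.1.adicCompletion L)), k ∈ unitaryInt (galAdicCompletionMap (L := L) (IsCMField.complexConj L) hw) ((StdForm.antidiagonal 3).over (w.1.adicCompletion L)) ∧
        ∃ n : ℤ, M = mapGL (k : GL (Fin 3) (w.1.adicCompletion L)) (latt (Matrix.diagonal ![ϖ ^ n, 1, ϖ ^ (-n)])))
    (htr₂ : ∀ M : Submodule 𝒪[(w.1.adicCompletion L)] (Fin 3 → (w.1.adicCompletion L)), IsVertexLattice (galAdicCompletionMap (L := L) (IsCMField.complexConj L) hw) ϖ ((StdForm.antidiagonal 3).over (w.1.adicCompletion L)) 2 M →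
      ∃ u : unitaryGroupOfForm (galAdicCompletionMap (L := L) (IsCMField.complexConj L) hw) ((StdForm.antidiagonal 3).over (w.1.adicCompletion L)), M = mapGL (u : GL (Fin 3) (w.1.adicCompletion L)) (latt (Matrix.diagonal ![(1 : (w.1.adicCompletion L)), 1, ϖ])))
    (eA : Gqs L v ≃ₜ* ↥(unitaryGroupOfForm (galAdicCompletionMap (L := L) (IsCMField.complexConj L) hw) ((StdForm.antidiagonal 3).over (w.1.adicCompletion L))))
    [MeasurableSpace (Gqs L v)] [BorelSpace (Gqs L v)]
    [∀ γ : Gqs L v, MeasurableSpace (Gqs L v ⧸ Subgroup.centralizer ({γ} : Set (Gqs L v)))]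
    [MeasurableSpace (Gqs L v ⧸ Subgroup.center (Gqs L v))]
    {H : Type} [Group H] [TopologicalSpace H] [IsTopologicalGroup H] [MeasurableSpace H]
    (νQv : Measure (Gqs L v)) [νQv.IsHaarMeasure]
    (𝔇 : EllipticData (Gqs L v) H) (hμG : 𝔇.μG = νQv)
    (r : SmoothIrrep (Gqs L v))
    (hrep : ∀ φ : Gqs L v → ℂ, IsLocSmooth φ → (IrrClass.mk r).smoothTrace 𝔇.μG φ = ∫ x, φ x * 𝔇.char (IrrClass.mk r) x ∂𝔇.μG)
    {a : Gqs L v →* ((latticeGraph (galAdicCompletionMap (L := L) (IsCMField.complexConj L) hw) ϖ ((StdForm.antidiagonal 3).over (w.1.adicCompletion L))) ≃g (latticeGraph (galAdicCompletionMap (L := L) (IsCMField.complexConj L) hw) ϖ ((StdForm.antidiagonal 3).over (w.1.adicCompletion L))))} (ha : ∀ g, a g = latticeGraphIso (galAdicCompletionMap (L := L) (IsCMField.complexConj L) hw) ϖ ((StdForm.antidiagonal 3).over (w.1.adicCompletion L)) (eA g))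
    (τ : Orientation (latticeGraph (galAdicCompletionMap (L := L) (IsCMField.complexConj L) hw) ϖ ((StdForm.antidiagonal 3).over (w.1.adicCompletion L)))) (hτ : ∀ d, τ.tail d < τ.head d)
    {e : ℕ} {U : {M : Submodule 𝒪[(w.1.adicCompletion L)] (Fin 3 → (w.1.adicCompletion L)) // IsVertex (galAdicCompletionMap (L := L) (IsCMField.complexConj L) hw) ϖ ((StdForm.antidiagonal 3).over (w.1.adicCompletion L)) M} → Subgroup (Gqs L v)}
    (hU : ∀ x g, g ∈ U x ↔ mapGL ((eA g : ↥(unitaryGroupOfForm (galAdicCompletionMap (L := L) (IsCMField.complexConj L) hw) ((StdForm.antidiagonal 3).over (w.1.adicCompletion L)))) : GL (Fin 3) (w.1.adicCompletion L)) x.1 = x.1 ∧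
      x.1.map ((Matrix.toLin' ((((eA g : ↥(unitaryGroupOfForm (galAdicCompletionMap (L := L) (IsCMField.complexConj L) hw) ((StdForm.antidiagonal 3).over (w.1.adicCompletion L)))) : GL (Fin 3) (w.1.adicCompletion L)) : Matrix (Fin 3) (Fin 3) (w.1.adicCompletion L)) - 1)).restrictScalars 𝒪[(w.1.adicCompletion L)]) ≤ scaleLattice (ϖ ^ (e + 1)) x.1)
    (hUo : ∀ x, IsOpen (U x : Set (Gqs L v))) (hUc : ∀ x, IsCompact (U x : Set (Gqs L v)))
    (hEo : ∀ d : (latticeGraph (galAdicCompletionMap (L := L) (IsCMField.complexConj L) hw) ϖ ((StdForm.antidiagonal 3).over (w.1.adicCompletion L))).edgeSet, IsOpen ((U (τ.head d) ⊔ U (τ.tail d) : Subgroup (Gqs L v)) : Set (Gqs L v)))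
    (hEc : ∀ d : (latticeGraph (galAdicCompletionMap (L := L) (IsCMField.complexConj L) hw) ϖ ((StdForm.antidiagonal 3).over (w.1.adicCompletion L))).edgeSet, IsCompact ((U (τ.head d) ⊔ U (τ.tail d) : Subgroup (Gqs L v)) : Set (Gqs L v)))
    (he : ∃ x₀ : {M : Submodule 𝒪[(w.1.adicCompletion L)] (Fin 3 → (w.1.adicCompletion L)) // IsVertex (galAdicCompletionMap (L := L) (IsCMField.complexConj L) hw) ϖ ((StdForm.antidiagonal 3).over (w.1.adicCompletion L)) M}, r.ρ.fixedPoints (U x₀) ≠ ⊥)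
    {γ : Gqs L v} (hne : ∃ o, a γ o = o) (hfin : {x : {M : Submodule 𝒪[(w.1.adicCompletion L)] (Fin 3 → (w.1.adicCompletion L)) // IsVertex (galAdicCompletionMap (L := L) (IsCMField.complexConj L) hw) ϖ ((StdForm.antidiagonal 3).over (w.1.adicCompletion L)) M} | a γ x = x}.Finite) (hfinE : {d : (latticeGraph (galAdicCompletionMap (L := L) (IsCMField.complexConj L) hw) ϖ ((StdForm.antidiagonal 3).over (w.1.adicCompletion L))).edgeSet | (a γ).mapEdgeSet d = d}.Finite)
    (hHC : ∀ᶠ g in nhds γ, 𝔇.char (IrrClass.mk r) g = 𝔇.char (IrrClass.mk r) γ) :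
    𝔇.char (IrrClass.mk r) γ =
      (∑ x ∈ hfin.toFinset, r.ρ.levelTrace (hUo x) (hUc x) γ) - ∑ d ∈ hfinE.toFinset, r.ρ.levelTrace (hEo d) (hEc d) γ := by
  classical
  haveI : r.ρ.IsIrreducible := r.isIrreducible
  haveI : NonarchimedeanGroup (Gqs L v) :=
    nonarchimedeanGroup_unitaryGroupOfForm_local (E := L) (c := IsCMField.complexConj L) (N := 3) (v := v) (J' := (adelicForm L 3 (qsForm L)).map (adeleToLocal L v))
  have hconn := hT.1
  have hadm : r.ρ.IsAdmissible := F0P3cStCharTSScTracePackage.isAdmissible_smoothIrrep L v hns r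
  have hσa : ∀ (g : Gqs L v) (d : (latticeGraph (galAdicCompletionMap (L := L) (IsCMField.complexConj L) hw) ϖ ((StdForm.antidiagonal 3).over (w.1.adicCompletion L))).edgeSet), τ.head ((a g).mapEdgeSet d) = a g (τ.head d) ∧ τ.tail ((a g).mapEdgeSet d) = a g (τ.tail d) := fun g d => by
    rw [ha]; exact head_mapEdgeSet_latticeGraphIso (galAdicCompletionMap (L := L) (IsCMField.complexConj L) hw) ϖ ((StdForm.antidiagonal 3).over (w.1.adicCompletion L)) hτ (eA g) d
  -- the base vertex `o ∈ X^γ` and its stabiliser `P`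
  obtain ⟨o, ho⟩ := hne
  obtain ⟨P₀, hP₀⟩ := exists_stabilizerSubgroup (galAdicCompletionMap (L := L) (IsCMField.complexConj L) hw) ϖ ((StdForm.antidiagonal 3).over (w.1.adicCompletion L)) o
  have hPmem : ∀ g : Gqs L v, g ∈ P₀.comap eA.toMonoidHom ↔ a g o = o := fun g => by rw [mem_comap_iff', hP₀, ha]
  have hPo : IsOpen ((P₀.comap eA.toMonoidHom : Subgroup (Gqs L v)) : Set (Gqs L v)) := by
    have hset : ((P₀.comap eA.toMonoidHom : Subgroup (Gqs L v)) : Set (Gqs L v)) = {g : Gqs L v | a g o = o} := Set.ext hPmem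
    rw [hset]; exact isOpen_setOf_actionHom_apply_eq ha o
  have hPc : IsCompact ((P₀.comap eA.toMonoidHom : Subgroup (Gqs L v)) : Set (Gqs L v)) := by
    haveI := compactSpace_integer_adicCompletion L w.1
    have hset : (P₀ : Set ↥(unitaryGroupOfForm (galAdicCompletionMap (L := L) (IsCMField.complexConj L) hw) ((StdForm.antidiagonal 3).over (w.1.adicCompletion L)))) = {u | latticeGraphIso (galAdicCompletionMap (L := L) (IsCMField.complexConj L) hw) ϖ ((StdForm.antidiagonal 3).over (w.1.adicCompletion L)) u o = o} := Set.ext hP₀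
    refine isCompact_coe_comap eA P₀ ?_
    rw [hset]
    exact isCompact_setOf_latticeGraphIso_apply_eq (galAdicCompletionMap (L := L) (IsCMField.complexConj L) hw) ϖ ((StdForm.antidiagonal 3).over (w.1.adicCompletion L)) (continuous_galAdicCompletionMap L (IsCMField.complexConj L) hw) o
  have hγP : γ ∈ P₀.comap eA.toMonoidHom := (hPmem γ).2 ho
  -- the auxiliary group `K` (★ 41c, Korman Claim 39)
  obtain ⟨K, hKo, hKc, hKP, hKU₀, hKγ, hKΘ, hKn⟩ := Subgroup.exists_aux_subgroup_of_eventually_eq_finset (P₀.comap eA.toMonoidHom) hPo hPc hγP U hfin.toFinset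
    (fun x _ => hUo x) hHC
  have hγK : γ ∈ Subgroup.normalizer (K : Set (Gqs L v)) := by
    rw [Subgroup.mem_normalizer_iff]
    intro c
    constructor
    · exact hKγ c
    · intro hc
      have h := hKn γ⁻¹ (Subgroup.inv_mem _ hγP) _ hc
      rwa [inv_inv, ← mul_assoc, ← mul_assoc, inv_mul_cancel, one_mul, inv_mul_cancel_right] at h
  have hKUfix : ∀ x, a γ x = x → K ≤ U x := fun x hx => hKU₀ x (hfin.mem_toFinset.2 hx)
  -- generation at level `e` (★ row 23) and the finite carrier of `V^K` (★ 41c)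
  have hgen : ⨆ x, r.ρ.fixedPoints (U x) = ⊤ := by
    obtain ⟨x₀, hx₀⟩ := he
    refine top_le_iff.1 ?_
    rw [← r.ρ.iSup_fixedPoints_map_conj_eq_top (U x₀) hx₀]
    refine iSup_le fun g => ?_
    rw [← unitaryLevel_gqs_actionHom_eq_map_conj ha hU g x₀]
    exact le_iSup (fun x => r.ρ.fixedPoints (U x)) _
  obtain ⟨S₀, hS₀⟩ := r.ρ.exists_finset_fixedPoints_le_biSup_of_isAdmissible hadm ⟨K, hKo⟩ hKc U hgen
  -- the ball `S = B(o, R)` containing `X^γ⁰` and `S₀`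
  obtain ⟨R, hR⟩ := ClosedBall.exists_subset_setOf_dist_le (G := (latticeGraph (galAdicCompletionMap (L := L) (IsCMField.complexConj L) hw) ϖ ((StdForm.antidiagonal 3).over (w.1.adicCompletion L)))) (hfin.union S₀.finite_toSet) o
  have hS : {x : {M : Submodule 𝒪[(w.1.adicCompletion L)] (Fin 3 → (w.1.adicCompletion L)) // IsVertex (galAdicCompletionMap (L := L) (IsCMField.complexConj L) hw) ϖ ((StdForm.antidiagonal 3).over (w.1.adicCompletion L)) M} | (latticeGraph (galAdicCompletionMap (L := L) (IsCMField.complexConj L) hw) ϖ ((StdForm.antidiagonal 3).over (w.1.adicCompletion L))).dist o x ≤ R}.Finite := ClosedBall.finite_setOf_dist_le hloc hconn o R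
  have hfixS : ∀ x, a γ x = x → x ∈ {x : {M : Submodule 𝒪[(w.1.adicCompletion L)] (Fin 3 → (w.1.adicCompletion L)) // IsVertex (galAdicCompletionMap (L := L) (IsCMField.complexConj L) hw) ϖ ((StdForm.antidiagonal 3).over (w.1.adicCompletion L)) M} | (latticeGraph (galAdicCompletionMap (L := L) (IsCMField.complexConj L) hw) ϖ ((StdForm.antidiagonal 3).over (w.1.adicCompletion L))).dist o x ≤ R} := fun x hx => hR (Or.inl hx)
  have hS₀S : ∀ x ∈ S₀, x ∈ {x : {M : Submodule 𝒪[(w.1.adicCompletion L)] (Fin 3 → (w.1.adicCompletion L)) // IsVertex (galAdicCompletionMap (L := L) (IsCMField.complexConj L) hw) ϖ ((StdForm.antidiagonal 3).over (w.1.adicCompletion L)) M} | (latticeGraph (galAdicCompletionMap (L := L) (IsCMField.complexConj L) hw) ϖ ((StdForm.antidiagonal 3).over (w.1.adicCompletion L))).dist o x ≤ R} := fun x hx => hR (Or.inr hx)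
  have hP : ∀ g ∈ P₀.comap eA.toMonoidHom, ∀ x, a g x ∈ {x : {M : Submodule 𝒪[(w.1.adicCompletion L)] (Fin 3 → (w.1.adicCompletion L)) // IsVertex (galAdicCompletionMap (L := L) (IsCMField.complexConj L) hw) ϖ ((StdForm.antidiagonal 3).over (w.1.adicCompletion L)) M} | (latticeGraph (galAdicCompletionMap (L := L) (IsCMField.complexConj L) hw) ϖ ((StdForm.antidiagonal 3).over (w.1.adicCompletion L))).dist o x ≤ R} ↔ x ∈ {x : {M : Submodule 𝒪[(w.1.adicCompletion L)] (Fin 3 → (w.1.adicCompletion L)) // IsVertex (galAdicCompletionMap (L := L) (IsCMField.complexConj L) hw) ϖ ((StdForm.antidiagonal 3).over (w.1.adicCompletion L)) M} | (latticeGraph (galAdicCompletionMap (L := L) (IsCMField.complexConj L) hw) ϖ ((StdForm.antidiagonal 3).over (w.1.adicCompletion L))).dist o x ≤ R} :=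
    fun g hg x => ClosedBall.apply_mem_setOf_dist_le_iff (a g) ((hPmem g).1 hg) R x
  have hfd : ∀ x ∈ {x : {M : Submodule 𝒪[(w.1.adicCompletion L)] (Fin 3 → (w.1.adicCompletion L)) // IsVertex (galAdicCompletionMap (L := L) (IsCMField.complexConj L) hw) ϖ ((StdForm.antidiagonal 3).over (w.1.adicCompletion L)) M} | (latticeGraph (galAdicCompletionMap (L := L) (IsCMField.complexConj L) hw) ϖ ((StdForm.antidiagonal 3).over (w.1.adicCompletion L))).dist o x ≤ R}, FiniteDimensional ℂ (r.ρ.fixedPoints (U x)) := fun x _ => hadm.finite_fixedPoints ⟨U x, hUo x⟩ (hUc x)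
  have hKV : r.ρ.fixedPoints K ≤ ⨆ x ∈ {x : {M : Submodule 𝒪[(w.1.adicCompletion L)] (Fin 3 → (w.1.adicCompletion L)) // IsVertex (galAdicCompletionMap (L := L) (IsCMField.complexConj L) hw) ϖ ((StdForm.antidiagonal 3).over (w.1.adicCompletion L)) M} | (latticeGraph (galAdicCompletionMap (L := L) (IsCMField.complexConj L) hw) ϖ ((StdForm.antidiagonal 3).over (w.1.adicCompletion L))).dist o x ≤ R}, r.ρ.fixedPoints (U x) :=
    hS₀.trans (iSup₂_le fun x hx => le_biSup (fun x => r.ρ.fixedPoints (U x)) (hS₀S x hx))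
  -- ★ 41f on the ball
  have h41f := Representation.levelTrace_eq_fixedVertexSum_sub_fixedEdgeSum (ρ := r.ρ) hT τ hσa (isOpen_setOf_actionHom_apply_eq ha) U hUo hUc
    (fun x y hxy => coe_sup_unitaryLevel_gqs_eq_mul_of_adj_of_involution hU hvσ hϖ hxy) (fun x y z hxy hyz => coe_unitaryLevel_gqs_subset_mul_of_adj_of_dist_of_involution hU hσ hvσ hϖ hT hfr htr₂ hxy hyz)
    (unitaryLevel_gqs_actionHom_eq_map_conj ha hU) hEo hEc hadm.isSmooth hS (r := o) (ClosedBall.setOf_dist_le_rootClosed o R) hfd hP hγP ⟨o, ho⟩ hKo hKc hKP hγK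
    (fun x _ hx => hKUfix x hx) (fun c hc x hx => actionHom_apply_eq_of_mem ha hU (hKUfix x hx hc))
    (fun c hc x y hx hxy => actionHom_apply_eq_of_mem_of_adj_of_involution ha hU hvσ hϖ (hKUfix x hx hc) hxy) hKV
  -- the character as a level trace (★ row 25 §1 + ★ TRACE-COSET)
  have hchar : 𝔇.char (IrrClass.mk r) γ = r.ρ.levelTrace hKo hKc γ := by
    rw [F0P3cStCharTSKormanRemarkEight.char_eq_trace_fixedPoints_of_constOn_coset L v hns νQv 𝔇 hμG r hrep hKo hKc hγK hKΘ,
      r.ρ.levelTrace_eq_trace_restrict_of_mem_normalizer hKo hKc hγK]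
  -- the `S`-filtered sums are the sums over the fixed sets
  have hV : hS.toFinset.filter (fun x => a γ x = x) = hfin.toFinset := by
    ext x
    simp only [Finset.mem_filter, Set.Finite.mem_toFinset, Set.mem_setOf_eq]
    exact ⟨fun h => h.2, fun h => ⟨hfixS x h, h⟩⟩
  have hE' : (Representation.finite_edges_of_finite τ hS).toFinset.filter (fun d => (a γ).mapEdgeSet d = d) = hfinE.toFinset := by
    ext d
    simp only [Finset.mem_filter, Set.Finite.mem_toFinset, Set.mem_setOf_eq]
    refine ⟨fun h => h.2, fun h => ⟨?_, h⟩⟩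
    obtain ⟨hh, ht⟩ := (hσa γ d)
    rw [h] at hh ht
    exact ⟨hfixS _ hh.symm, hfixS _ ht.symm⟩
  rw [hchar, h41f, hV, hE']


set_option maxHeartbeats 1600000 in
/-- **(SS-K) UNIFORM AT A TAME RAMIFIED PLACE** (`σϖ = −ϖ`, `hres`, `|2| = 1`, `hnorm`): the place-free head with its tree-side hypotheses DISCHARGED — the tree by
★ `isTree_latticeGraph_three_of_neg`, local finiteness by ★ `ncard_sphere_of_neg` (`m = 1`; the residue field of `L_w` is finite, ★ `finite_residueField_adicCompletion`), the frames
by ★ `exists_frame_three_of_isSelfDualLattice_of_neg` and type-two transitivity by ★ `forall_isVertexLattice_two_exists_mapGL_N₁_eq_of_neg`.  Conclusion VERBATIM = ★ 41g-H.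
WILD (dyadic) places stay PRINT (`h2` is a binder). [cite: SchneiderStuhler1997, Thm. III.4.16] [cite: Korman2004, Theorem 40] [cite: MeyerSolleveld2010, Prop. 4.1] [cite: Rogawski1990, §12.5 pp. 182–187] -/
theorem char_eq_fixedVertexSum_sub_fixedEdgeSum_of_neg
    (hns : ∀ w : PlacesOver L v, IsCMField.complexConj L • w.1 = w.1)
    (w : PlacesOver L v) (hw : IsCMField.complexConj L • w.1 = w.1) {ϖ : w.1.adicCompletion L} (hσ : ∀ a, (galAdicCompletionMap (L := L) (IsCMField.complexConj L) hw) ((galAdicCompletionMap (L := L) (IsCMField.complexConj L) hw) a) = a) (hvσ : ∀ a, Valued.v ((galAdicCompletionMap (L := L) (IsCMField.complexConj L) hw) a) = Valued.v a)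
    (hϖ : Valued.v ϖ = WithZero.exp (-1 : ℤ)) (hσϖ : (galAdicCompletionMap (L := L) (IsCMField.complexConj L) hw) ϖ = -ϖ)
    (hres : ∀ x : (w.1.adicCompletion L), Valued.v x ≤ 1 → Valued.v ((galAdicCompletionMap (L := L) (IsCMField.complexConj L) hw) x - x) < 1) (h2 : Valued.v (2 : (w.1.adicCompletion L)) = 1)
    (hnorm : ∀ u : (w.1.adicCompletion L), (galAdicCompletionMap (L := L) (IsCMField.complexConj L) hw) u = u → Valued.v (u - 1) < 1 → ∃ z : (w.1.adicCompletion L), z * (galAdicCompletionMap (L := L) (IsCMField.complexConj L) hw) z = u ∧ Valued.v (z - 1) ≤ Valued.v (u - 1))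
    (eA : Gqs L v ≃ₜ* ↥(unitaryGroupOfForm (galAdicCompletionMap (L := L) (IsCMField.complexConj L) hw) ((StdForm.antidiagonal 3).over (w.1.adicCompletion L))))
    [MeasurableSpace (Gqs L v)] [BorelSpace (Gqs L v)]
    [∀ γ : Gqs L v, MeasurableSpace (Gqs L v ⧸ Subgroup.centralizer ({γ} : Set (Gqs L v)))]
    [MeasurableSpace (Gqs L v ⧸ Subgroup.center (Gqs L v))]
    {H : Type} [Group H] [TopologicalSpace H] [IsTopologicalGroup H] [MeasurableSpace H]
    (νQv : Measure (Gqs L v)) [νQv.IsHaarMeasure]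
    (𝔇 : EllipticData (Gqs L v) H) (hμG : 𝔇.μG = νQv)
    (r : SmoothIrrep (Gqs L v))
    (hrep : ∀ φ : Gqs L v → ℂ, IsLocSmooth φ → (IrrClass.mk r).smoothTrace 𝔇.μG φ = ∫ x, φ x * 𝔇.char (IrrClass.mk r) x ∂𝔇.μG)
    {a : Gqs L v →* ((latticeGraph (galAdicCompletionMap (L := L) (IsCMField.complexConj L) hw) ϖ ((StdForm.antidiagonal 3).over (w.1.adicCompletion L))) ≃g (latticeGraph (galAdicCompletionMap (L := L) (IsCMField.complexConj L) hw) ϖ ((StdForm.antidiagonal 3).over (w.1.adicCompletion L))))} (ha : ∀ g, a g = latticeGraphIso (galAdicCompletionMap (L := L) (IsCMField.complexConj L) hw) ϖ ((StdForm.antidiagonal 3).over (w.1.adicCompletion L)) (eA g))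
    (τ : Orientation (latticeGraph (galAdicCompletionMap (L := L) (IsCMField.complexConj L) hw) ϖ ((StdForm.antidiagonal 3).over (w.1.adicCompletion L)))) (hτ : ∀ d, τ.tail d < τ.head d)
    {e : ℕ} {U : {M : Submodule 𝒪[(w.1.adicCompletion L)] (Fin 3 → (w.1.adicCompletion L)) // IsVertex (galAdicCompletionMap (L := L) (IsCMField.complexConj L) hw) ϖ ((StdForm.antidiagonal 3).over (w.1.adicCompletion L)) M} → Subgroup (Gqs L v)}
    (hU : ∀ x g, g ∈ U x ↔ mapGL ((eA g : ↥(unitaryGroupOfForm (galAdicCompletionMap (L := L) (IsCMField.complexConj L) hw) ((StdForm.antidiagonal 3).over (w.1.adicCompletion L)))) : GL (Fin 3) (w.1.adicCompletion L)) x.1 = x.1 ∧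
      x.1.map ((Matrix.toLin' ((((eA g : ↥(unitaryGroupOfForm (galAdicCompletionMap (L := L) (IsCMField.complexConj L) hw) ((StdForm.antidiagonal 3).over (w.1.adicCompletion L)))) : GL (Fin 3) (w.1.adicCompletion L)) : Matrix (Fin 3) (Fin 3) (w.1.adicCompletion L)) - 1)).restrictScalars 𝒪[(w.1.adicCompletion L)]) ≤ scaleLattice (ϖ ^ (e + 1)) x.1)
    (hUo : ∀ x, IsOpen (U x : Set (Gqs L v))) (hUc : ∀ x, IsCompact (U x : Set (Gqs L v)))
    (hEo : ∀ d : (latticeGraph (galAdicCompletionMap (L := L) (IsCMField.complexConj L) hw) ϖ ((StdForm.antidiagonal 3).over (w.1.adicCompletion L))).edgeSet, IsOpen ((U (τ.head d) ⊔ U (τ.tail d) : Subgroup (Gqs L v)) : Set (Gqs L v)))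
    (hEc : ∀ d : (latticeGraph (galAdicCompletionMap (L := L) (IsCMField.complexConj L) hw) ϖ ((StdForm.antidiagonal 3).over (w.1.adicCompletion L))).edgeSet, IsCompact ((U (τ.head d) ⊔ U (τ.tail d) : Subgroup (Gqs L v)) : Set (Gqs L v)))
    (he : ∃ x₀ : {M : Submodule 𝒪[(w.1.adicCompletion L)] (Fin 3 → (w.1.adicCompletion L)) // IsVertex (galAdicCompletionMap (L := L) (IsCMField.complexConj L) hw) ϖ ((StdForm.antidiagonal 3).over (w.1.adicCompletion L)) M}, r.ρ.fixedPoints (U x₀) ≠ ⊥)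
    {γ : Gqs L v} (hne : ∃ o, a γ o = o) (hfin : {x : {M : Submodule 𝒪[(w.1.adicCompletion L)] (Fin 3 → (w.1.adicCompletion L)) // IsVertex (galAdicCompletionMap (L := L) (IsCMField.complexConj L) hw) ϖ ((StdForm.antidiagonal 3).over (w.1.adicCompletion L)) M} | a γ x = x}.Finite) (hfinE : {d : (latticeGraph (galAdicCompletionMap (L := L) (IsCMField.complexConj L) hw) ϖ ((StdForm.antidiagonal 3).over (w.1.adicCompletion L))).edgeSet | (a γ).mapEdgeSet d = d}.Finite)
    (hHC : ∀ᶠ g in nhds γ, 𝔇.char (IrrClass.mk r) g = 𝔇.char (IrrClass.mk r) γ) :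
    𝔇.char (IrrClass.mk r) γ =
      (∑ x ∈ hfin.toFinset, r.ρ.levelTrace (hUo x) (hUc x) γ) - ∑ d ∈ hfinE.toFinset, r.ρ.levelTrace (hEo d) (hEc d) γ := by
  haveI : Finite 𝓀[(w.1.adicCompletion L)] := finite_residueField_adicCompletion (K := L) (v := w.1)
  have hT := isTree_latticeGraph_three_of_neg hσ hvσ hϖ hσϖ hres h2 hnorm
  have hloc : ∀ x : {M : Submodule 𝒪[(w.1.adicCompletion L)] (Fin 3 → (w.1.adicCompletion L)) // IsVertex (galAdicCompletionMap (L := L) (IsCMField.complexConj L) hw) ϖ ((StdForm.antidiagonal 3).over (w.1.adicCompletion L)) M}, ((latticeGraph (galAdicCompletionMap (L := L) (IsCMField.complexConj L) hw) ϖ ((StdForm.antidiagonal 3).over (w.1.adicCompletion L))).neighborSet x).Finite := fun x => by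
    have hn := ncard_sphere_of_neg hσ hvσ hσϖ hϖ hres h2 hnorm x (m := 1) le_rfl
    have hfin : {y | (latticeGraph (galAdicCompletionMap (L := L) (IsCMField.complexConj L) hw) ϖ ((StdForm.antidiagonal 3).over (w.1.adicCompletion L))).dist x y = 1}.Finite :=
      Set.finite_of_ncard_ne_zero (by rw [hn, pow_zero, mul_one]; exact Nat.succ_ne_zero _)
    exact hfin.subset fun y hy => SimpleGraph.dist_eq_one_iff_adj.2 ((SimpleGraph.mem_neighborSet _ _ _).1 hy)
  exact char_eq_fixedVertexSum_sub_fixedEdgeSum_of_involution L v hns w hw hσ hvσ hϖ hT hloc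
    (exists_frame_three_of_isSelfDualLattice_of_neg hσ hvσ hϖ h2) (forall_isVertexLattice_two_exists_mapGL_N₁_eq_of_neg hσ hvσ hϖ hσϖ hres h2 hnorm)
    eA νQv 𝔇 hμG r hrep ha τ hτ hU hUo hUc hEo hEc he hne hfin hfinE hHC

end Head

end Summit.HodgeConjecture.HodgeConjecture.Cruxes.H413.F0P3cStCharTSCharacterEllipticUniformRamified
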